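import Literature.Computability.Complexity.LupanovBound
import HarnessLib

/-!
# Uhlig's mass-production theorem: `r` copies of any Boolean function at the price of one

Topic `Computability/Complexity`, continuing `LupanovBound.lean`. For a Boolean
function `f : {0,1}ⁿ → {0,1}` and `r ∈ ℕ`, the *`r`-fold direct product* `r × f` maps `r` input
vectors `a¹, …, aʳ ∈ {0,1}ⁿ` to `(f(a¹), …, f(aʳ))`. Uhlig (1974) proved that for
`log r = o(n / log n)` the direct product is not harder than `f` itself for the hardest `f`:
`C(r × f) ≤ (1 + o(1)) 2ⁿ/n` (Wegener 1987, Thm. 10.2.3; Uhlig 1992, Thm. 2.1). This file PROVES the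
theorem in the weak form (constant factor instead of `1 + o(1)`, which is what Hirahara's
reduction to `MCSP*` consumes as his Lemma 8.2):

* `cktSize_massProduction` — if `(2 t + 8) (⌊log₂ n⌋ + 2) ≤ n` then for every `f : {0,1}ⁿ → {0,1}`
  and every index set `ρ` with `|ρ| ≤ 2ᵗ`, the map `X ↦ (f (X p))_{p ∈ ρ}` on inputs
  `X : ρ × Fin n → {0,1}` has a `B₂`-circuit of size `≤ 160 · 2ⁿ / n`
  (`CktSize B2 (directProd ρ f) (160 * 2 ^ n / n)`).

The proof is Uhlig's "new and simple" inductive construction of 1992, verbatim up to constants.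

**One level** (Uhlig 1992, eqs. (7)–(10)). Split the variables into `m` data bits and `k` index bits,
enumerate the `2ᵏ` index patterns as `c₀, …, c_{L-1}` (`L = 2ᵏ`), let `fᵢ := f(·, cᵢ)` be the
subfunctions and put `F(0) := 0`, `F(i+1) := fᵢ` (`:= 0` for `i ≥ L`) and `g_ℓ := F(ℓ) ⊕ F(ℓ+1)`,
`ℓ = 0, …, L`. Then (telescoping) `fᵢ = ⊕_{ℓ ≤ i} g_ℓ = ⊕_{ℓ > i} g_ℓ`. Given a PAIR of input
vectors `a, b` with index numbers `i, j`, feed to `g_ℓ` the data part of `a` if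
`ℓ ≤ i ≤ j ∨ j < i < ℓ` and the data part of `b` otherwise; then `f(a)` is the parity of the
selected `g_ℓ`-values and `f(b)` the parity of the values with `i ≤ j < ℓ ∨ ℓ ≤ j < i` — every
`g_ℓ` is evaluated only ONCE for the pair (`Uhlig.levelOut_eq`).

**Induction** (Uhlig 1992, eqs. (21)–(23)). To evaluate `f ∈ B_{m+k}` on `2^{t+1}` vectors, group them
in `2ᵗ` pairs, compute the selections, evaluate each of the `L + 1` functions `g_ℓ ∈ B_m` on its
`2ᵗ` selected data vectors by the inductively given circuit, and finish with the masked parities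
(`Uhlig.cktSize_level`); the size `S` obeys `S(t+1, m+k) ≤ (2ᵏ+1) S(t, m) + 2ᵗ (2ᵏ+1) (10·4ᵏ + 4m + 6)`
with `S(0, n) = lupanovBound n ≤ 36 · 2ⁿ/n` (`LupanovBound.lean`). With `k = ⌊log₂ n⌋ + 1` (so that
`2ᵏ > n ≥ 2t` and `(2ᵏ+1)ᵗ ≤ 2 · 2^{kt}`, `Uhlig.succ_pow_le_two_mul_pow`) and `t (k+1) ≤ n/2 - 4(k+1)`
this is `O(2ⁿ/n)` (`Uhlig.mul_size_le`).

The control logic of a level (comparisons of `k`-bit numbers) is realised crudely by the universal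
bound `cktSize_univ` on the `2k` index bits of a pair — affordable, since a level handles only
`2ᵗ (2ᵏ+1)` (pair, `ℓ`) combinations; the parity chains `parityFin` come from `LupanovBound.lean`.

## References

* D. Uhlig, *Networks computing Boolean functions for multiple input values*, in: M. S. Paterson
  (ed.), *Boolean Function Complexity*, LMS Lecture Note Series 169, CUP 1992, pp. 165–173,
  Thm. 2.1 and its proof (eqs. (7)–(10), (17), (21)–(23)) [Uhlig1992]
  (read via `lit read book:paterson1992-boolean-function-complexity`, chunks p0152–p0157).
* D. Uhlig, *On the synthesis of self-correcting schemes from functional elements with a small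
  number of reliable elements*, Math. Notes Acad. Sci. USSR 15 (1974) 558–562.
* I. Wegener, *The Complexity of Boolean Functions*, Wiley–Teubner 1987, §10.2, Thm. 2.3
  (the case `r = 2`).
* S. Hirahara, *NP-hardness of learning programs and partial MCSP*, FOCS 2022 / ECCC TR22-119,
  Lemma 8.2 (the consumer in the tree).
-/

namespace Literature.Computability.Complexity

open Finset

/-- The `ρ`-indexed **direct product** of `f : {0,1}ⁿ → {0,1}`: on an input `X : ρ × Fin n → {0,1}`
(a `ρ`-indexed family of vectors) output the family of values `(f (X p))_{p ∈ ρ}`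
(Wegener 1987, Def. 10.2.1, `r × f`). [cite: Uhlig1992, §1 (networks computing f on r vectors)] -/
def directProd (ρ : Type*) {n : ℕ} (f : (Fin n → Bool) → Bool) : (ρ × Fin n → Bool) → ρ → Bool :=
  fun X p => f fun i => X (p, i)

namespace Uhlig

/-! ### Circuit combinators: bundles of multi-output programs, parity chains -/

variable {ι : Type*} {B : Set GateFn}

/-- Bundling `M` multi-output programs on the same inputs (outputs indexed by `Fin M × κ`): sizes
add. [cite: Vollmer1999, §1.2] -/
theorem cktSize_prodPi_fin {κ : Type*} {M : ℕ} {F : Fin M → (ι → Bool) → κ → Bool} {s : Fin M → ℕ}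
    (h : ∀ l, CktSize B (F l) (s l)) :
    CktSize B (fun x (lk : Fin M × κ) => F lk.1 x lk.2) (∑ l, s l) := by
  induction M with
  | zero =>
    rw [Finset.univ_eq_empty, Finset.sum_empty]
    haveI : IsEmpty (Fin 0 × κ) := by infer_instance
    exact CktSize.of_isEmpty B _
  | succ M ih =>
    have h1 : CktSize B (fun x (lk : Fin M × κ) => F lk.1.castSucc x lk.2) (∑ l : Fin M, s l.castSucc) :=
      ih fun l => h l.castSucc
    have h2 := h1.pair (h (Fin.last M))
    rw [Fin.sum_univ_castSucc]
    refine (h2.outMap fun lk : Fin (M + 1) × κ =>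
      if hl : (lk.1 : ℕ) < M then Sum.inl (⟨lk.1, hl⟩, lk.2) else Sum.inr lk.2).congr fun x lk => ?_
    obtain ⟨l, k⟩ := lk
    by_cases hl : (l : ℕ) < M
    · simp only [hl, ↓reduceDIte, Sum.elim_inl]
      rfl
    · simp only [hl, ↓reduceDIte, Sum.elim_inr]
      rw [Fin.eq_last_of_not_lt hl]

/-- Bundling a finite family of multi-output programs with a uniform size bound:
`card λ * s` gates. [cite: Vollmer1999, §1.2] -/
theorem cktSize_prodPi {κ μ : Type*} [Fintype μ] {F : μ → (ι → Bool) → κ → Bool} {s : ℕ}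
    (h : ∀ l, CktSize B (F l) s) :
    CktSize B (fun x (lk : μ × κ) => F lk.1 x lk.2) (Fintype.card μ * s) := by
  classical
  set e := Fintype.equivFin μ
  have h1 : CktSize B (fun x (lk : Fin (Fintype.card μ) × κ) => F (e.symm lk.1) x lk.2)
      (∑ _l : Fin (Fintype.card μ), s) := cktSize_prodPi_fin fun l => h (e.symm l)
  simp only [sum_const, card_univ, Fintype.card_fin, smul_eq_mul] at h1
  exact (h1.outMap fun lk : μ × κ => (e lk.1, lk.2)).congr fun x lk => by simp

/-- The **masked parity** `⊕_{ℓ < M} (c_ℓ ∧ u_ℓ)` of `M` value bits `u` (wires `inl`) under `M`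
control bits `c` (wires `inr`) costs `2M + 1` gates. [cite: Uhlig1992, proof of Thm. 2.1 (networks V and S_⊕)] -/
theorem cktSize_maskedParity (M : ℕ) :
    CktSize B2 (fun (w : Fin M ⊕ Fin M → Bool) (_ : Unit) =>
      parityFin M fun ℓ => w (.inr ℓ) && w (.inl ℓ)) (2 * M + 1) := by
  have hA : CktSize B2 (fun (w : Fin M ⊕ Fin M → Bool) (ℓ : Fin M) => w (.inr ℓ) && w (.inl ℓ))
      (Fintype.card (Fin M) * 1) := CktSize.pi_const fun ℓ => cktSize_and _ _
  have h := hA.comp (cktSize_parityFin M)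
  rw [Fintype.card_fin, mul_one] at h
  exact h.of_le (by omega)

/-! ### Masked telescoping for parity chains -/

/-- A parity chain all of whose terms vanish is `0`. [folklore] -/
theorem parityFin_eq_false_of_forall {M : ℕ} (z : Fin M → Bool) (hz : ∀ j, z j = false) :
    parityFin M z = false := by
  have : z = fun _ => false := funext hz
  rw [this, parityFin_false]

/-- **Masked telescoping.** If the control bits select exactly the window `lo ≤ ℓ ≤ hi` (with
`hi < M`, `lo ≤ hi + 1`) and on the window the values are `u_ℓ = A(ℓ) ⊕ A(ℓ+1)`, then the masked
parity is `A(lo) ⊕ A(hi+1)`. [cite: Uhlig1992, proof of Thm. 2.1, eqs. (7)–(10)] -/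
theorem parityFin_window : ∀ {M lo hi : ℕ}, hi < M → lo ≤ hi + 1 → ∀ (c u : Fin M → Bool)
    (A : ℕ → Bool), (∀ ℓ : Fin M, c ℓ = decide (lo ≤ (ℓ : ℕ) ∧ (ℓ : ℕ) ≤ hi)) →
    (∀ ℓ : Fin M, lo ≤ (ℓ : ℕ) → (ℓ : ℕ) ≤ hi → u ℓ = xor (A ℓ) (A (ℓ + 1))) →
    parityFin M (fun ℓ => c ℓ && u ℓ) = xor (A lo) (A (hi + 1))
  | 0, _, _, hhi, _, _, _, _, _, _ => absurd hhi (Nat.not_lt_zero _)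
  | M + 1, lo, hi, hhi, hlo, c, u, A, hc, hu => by
    rw [parityFin]
    rcases Nat.lt_or_ge hi M with hlt | hge
    · -- the window lies inside the first `M` positions: the last term vanishes
      have hlast : (c (Fin.last M) && u (Fin.last M)) = false := by
        rw [hc]; simp only [Fin.val_last, Bool.and_eq_false_imp, decide_eq_true_eq]; omega
      rw [hlast, Bool.xor_false]
      exact parityFin_window hlt hlo (fun j => c j.castSucc) (fun j => u j.castSucc) A
        (fun ℓ => hc ℓ.castSucc) (fun ℓ h1 h2 => hu ℓ.castSucc h1 h2)
    · -- `hi = M`: the last term is `A(M) ⊕ A(M+1)` (if `lo ≤ M`), the rest telescopes to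
      -- `A(lo) ⊕ A(M)`
      have hMhi : M = hi := by omega
      subst hMhi
      rcases Nat.lt_or_ge M lo with hMlo | hloM
      · -- empty window
        obtain rfl : lo = M + 1 := by omega
        have hlast : (c (Fin.last M) && u (Fin.last M)) = false := by
          rw [hc]; simp only [Bool.and_eq_false_imp, decide_eq_true_eq]; omega
        rw [hlast, Bool.xor_false, Bool.xor_self]
        refine parityFin_eq_false_of_forall _ fun j => ?_
        rw [hc]; simp only [Fin.val_castSucc, Bool.and_eq_false_imp, decide_eq_true_eq]
        have := j.isLt; omega
      · have hlast : (c (Fin.last M) && u (Fin.last M)) = xor (A M) (A (M + 1)) := by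
          rw [hc, hu (Fin.last M) (by simpa using hloM) (by simp)]
          simp [hloM]
        rw [hlast]
        rcases Nat.eq_zero_or_pos M with rfl | hMpos
        · obtain rfl : lo = 0 := by omega
          rw [parityFin]; simp
        · have hrest : parityFin M (fun j => c j.castSucc && u j.castSucc) = xor (A lo) (A M) := by
            have h := parityFin_window (M := M) (lo := lo) (hi := M - 1) (by omega) (by omega)
              (fun j => c j.castSucc) (fun j => u j.castSucc) A
              (fun ℓ => by rw [hc]; simp only [Fin.val_castSucc, decide_eq_decide]; have := ℓ.isLt; omega)
              (fun ℓ h1 _ => hu ℓ.castSucc h1 (by have := ℓ.isLt; simp only [Fin.val_castSucc]; omega))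
            rwa [Nat.sub_add_cancel hMpos] at h
          rw [hrest]
          cases A lo <;> cases A M <;> cases A (M + 1) <;> rfl

/-! ### Subfunctions and the telescoping representation -/

section Level

variable {m k : ℕ} (f : (Fin (m + k) → Bool) → Bool)

/-- The number of index patterns, `L = |{0,1}ᵏ| = 2ᵏ`. [cite: Uhlig1992, proof of Thm. 2.1] -/
abbrev numIdx (k : ℕ) : ℕ := Fintype.card (Fin k → Bool)

/-- The number `< L` of an index pattern `c ∈ {0,1}ᵏ` (any fixed enumeration). [cite: Uhlig1992, proof of Thm. 2.1 ("binary representation of i")] -/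
noncomputable def num (c : Fin k → Bool) : ℕ := Fintype.equivFin (Fin k → Bool) c

/-- Index numbers are `< L`. [folklore] -/
theorem num_lt (c : Fin k → Bool) : num c < numIdx k := (Fintype.equivFin _ c).isLt

/-- The shifted subfunction table: `F(0) = 0`, `F(i+1) = f(·, cᵢ)` for `i < L`, `F(i+1) = 0` for
`i ≥ L`. [cite: Uhlig1992, proof of Thm. 2.1 (the subfunctions fᵢ)] -/
noncomputable def subFn : ℕ → (Fin m → Bool) → Bool
  | 0 => fun _ => false
  | i + 1 => fun d =>
    if h : i < numIdx k then f (Fin.append d ((Fintype.equivFin (Fin k → Bool)).symm ⟨i, h⟩))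
    else false

/-- `g_ℓ = F(ℓ) ⊕ F(ℓ+1)` (`g₀ = f₀`, `g_ℓ = f_{ℓ-1} ⊕ f_ℓ`, `g_L = f_{L-1}`). [cite: Uhlig1992, proof of Thm. 2.1 (the functions g_ℓ)] -/
noncomputable def gFn (ℓ : ℕ) : (Fin m → Bool) → Bool := fun d => xor (subFn f ℓ d) (subFn f (ℓ + 1) d)

/-- The data part (first `m` bits) of a vector. [cite: Uhlig1992, proof of Thm. 2.1] -/
def dataOf (x : Fin (m + k) → Bool) : Fin m → Bool := fun q => x (Fin.castAdd k q)

/-- The index part (last `k` bits) of a vector. [cite: Uhlig1992, proof of Thm. 2.1] -/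
def idxOf (x : Fin (m + k) → Bool) : Fin k → Bool := fun q => x (Fin.natAdd m q)

/-- `F(0) = 0`. [cite: Uhlig1992, proof of Thm. 2.1 (the functions g_ℓ)] -/
theorem subFn_zero (d : Fin m → Bool) : subFn f 0 d = false := rfl

/-- `F(L+1) = 0`. [cite: Uhlig1992, proof of Thm. 2.1 (the functions g_ℓ)] -/
theorem subFn_numIdx_succ (d : Fin m → Bool) : subFn f (numIdx k + 1) d = false := by
  simp [subFn]

/-- `f(x) = F(num(idx x) + 1)(data x)`. [cite: Uhlig1992, proof of Thm. 2.1] -/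
theorem subFn_num_succ (x : Fin (m + k) → Bool) : subFn f (num (idxOf x) + 1) (dataOf x) = f x := by
  show (if h : num (idxOf x) < numIdx k then
      f (Fin.append (dataOf x) ((Fintype.equivFin (Fin k → Bool)).symm ⟨num (idxOf x), h⟩)) else false) = f x
  rw [dif_pos (num_lt _)]
  have he : (Fintype.equivFin (Fin k → Bool)).symm ⟨num (idxOf x), num_lt _⟩ = idxOf x := by
    unfold num
    simp
  rw [he]
  exact congrArg f Fin.append_castAdd_natAdd

/-- **Prefix telescoping**: `⊕_{ℓ ≤ i} g_ℓ(d) = F(i+1)(d)` as a masked parity over `ℓ < L + 1`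
with the window `[0, i]`. [cite: Uhlig1992, proof of Thm. 2.1, eqs. (7), (9)] -/
theorem parity_prefix {i : ℕ} (hi : i < numIdx k) (c u : Fin (numIdx k + 1) → Bool) (d : Fin m → Bool)
    (hc : ∀ ℓ : Fin (numIdx k + 1), c ℓ = decide ((ℓ : ℕ) ≤ i))
    (hu : ∀ ℓ : Fin (numIdx k + 1), (ℓ : ℕ) ≤ i → u ℓ = gFn f ℓ d) :
    parityFin (numIdx k + 1) (fun ℓ => c ℓ && u ℓ) = subFn f (i + 1) d := by
  have h := parityFin_window (lo := 0) (hi := i) (by omega) (by omega) c u (fun ℓ => subFn f ℓ d)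
    (fun ℓ => by rw [hc ℓ]; simp) (fun ℓ _ hℓ => hu ℓ hℓ)
  rw [h, subFn_zero, Bool.false_xor]

/-- **Suffix telescoping**: `⊕_{ℓ > i} g_ℓ(d) = F(i+1)(d)` as a masked parity over `ℓ < L + 1`
with the window `[i+1, L]`. [cite: Uhlig1992, proof of Thm. 2.1, eqs. (8), (10)] -/
theorem parity_suffix {i : ℕ} (hi : i < numIdx k) (c u : Fin (numIdx k + 1) → Bool) (d : Fin m → Bool)
    (hc : ∀ ℓ : Fin (numIdx k + 1), c ℓ = decide (i < (ℓ : ℕ)))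
    (hu : ∀ ℓ : Fin (numIdx k + 1), i < (ℓ : ℕ) → u ℓ = gFn f ℓ d) :
    parityFin (numIdx k + 1) (fun ℓ => c ℓ && u ℓ) = subFn f (i + 1) d := by
  have h := parityFin_window (lo := i + 1) (hi := numIdx k) (by omega) (by omega) c u
    (fun ℓ => subFn f ℓ d)
    (fun ℓ => by rw [hc ℓ]; have := ℓ.isLt; simp only [decide_eq_decide]; omega)
    (fun ℓ hℓ _ => hu ℓ hℓ)
  rw [h, subFn_numIdx_succ, Bool.xor_false]

/-! ### One level: two input vectors share the `g_ℓ` -/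

/-- Selection bit for the FIRST vector of a pair with index numbers `i, j`: `g_ℓ` reads the first
vector iff `ℓ ≤ i ≤ j` or `j < i < ℓ`. [cite: Uhlig1992, proof of Thm. 2.1 (network B_{n,k})] -/
def selA (i j ℓ : ℕ) : Bool := decide ((ℓ ≤ i ∧ i ≤ j) ∨ (j < i ∧ i < ℓ))

/-- Output mask for the SECOND vector: `i ≤ j < ℓ` or `ℓ ≤ j < i`. [cite: Uhlig1992, proof of Thm. 2.1 (functions f_{n,k,2,ℓ})] -/
def selB (i j ℓ : ℕ) : Bool := decide ((i ≤ j ∧ j < ℓ) ∨ (j < i ∧ ℓ ≤ j))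

/-- A pair of vectors, as one assignment of `Bool × Fin (m + k)` (`false` ↦ first, `true` ↦ second);
its two index numbers. [cite: Uhlig1992, proof of Thm. 2.1] -/
noncomputable def pairNum (x : Bool × Fin (m + k) → Bool) (s : Bool) : ℕ := num (idxOf fun q => x (s, q))

/-- The data vector fed to `g_ℓ` for the pair `x`. [cite: Uhlig1992, proof of Thm. 2.1 (outputs of B_{n,k})] -/
noncomputable def zVec (x : Bool × Fin (m + k) → Bool) (ℓ : ℕ) : Fin m → Bool := fun q =>
  if selA (pairNum x false) (pairNum x true) ℓ then x (false, Fin.castAdd k q)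
  else x (true, Fin.castAdd k q)

/-- The control bit of side `s` for index numbers `i, j` (`false`: selection bit = output mask of
the first vector; `true`: output mask of the second vector). [cite: Uhlig1992, proof of Thm. 2.1 (functions f_{n,k,j,ℓ})] -/
def ctrlNum (i j ℓ : ℕ) : Bool → Bool
  | false => selA i j ℓ
  | true => selB i j ℓ

/-- The control bits of a pair. [cite: Uhlig1992, proof of Thm. 2.1 (functions f_{n,k,j,ℓ})] -/
noncomputable def ctrl (x : Bool × Fin (m + k) → Bool) (ℓ : ℕ) (s : Bool) : Bool :=
  ctrlNum (pairNum x false) (pairNum x true) ℓ s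

/-- The two outputs of a level: masked parities of the shared values `g_ℓ(z_ℓ)`.
[cite: Uhlig1992, proof of Thm. 2.1 (network U_{n,k})] -/
noncomputable def levelOut (x : Bool × Fin (m + k) → Bool) (s : Bool) : Bool :=
  parityFin (numIdx k + 1) fun ℓ => ctrl x ℓ s && gFn f ℓ (zVec x ℓ)

/-- **Correctness of a level** (Uhlig 1992, eqs. (7)–(10)): the two masked parities are `f` of the
first and of the second vector. [cite: Uhlig1992, proof of Thm. 2.1, eqs. (7)–(10)] -/
theorem levelOut_eq (x : Bool × Fin (m + k) → Bool) (s : Bool) : levelOut f x s = f fun q => x (s, q) := by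
  set i := pairNum x false with hi
  set j := pairNum x true with hj
  have hiL : i < numIdx k := num_lt _
  have hjL : j < numIdx k := num_lt _
  have hdata : ∀ s : Bool, dataOf (fun q => x (s, q)) = fun q => x (s, Fin.castAdd k q) := fun _ => rfl
  rw [← subFn_num_succ f (fun q => x (s, q))]
  unfold levelOut ctrl ctrlNum
  rcases Nat.lt_or_ge j i with hji | hij
  · -- `j < i`: the first vector is read by `ℓ > i`, the second by `ℓ ≤ j`
    cases s
    · change parityFin _ (fun ℓ => selA i j ℓ && _) = subFn f (i + 1) _
      refine parity_suffix f hiL _ _ _ (fun ℓ => ?_) (fun ℓ hℓ => ?_)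
      · simp only [selA, decide_eq_decide]; omega
      · rw [hdata]; congr 1; funext q
        simp only [zVec, ← hi, ← hj, selA]
        rw [if_pos (by simp only [decide_eq_true_eq]; omega)]
    · change parityFin _ (fun ℓ => selB i j ℓ && _) = subFn f (j + 1) _
      refine parity_prefix f hjL _ _ _ (fun ℓ => ?_) (fun ℓ hℓ => ?_)
      · simp only [selB, decide_eq_decide]; omega
      · rw [hdata]; congr 1; funext q
        simp only [zVec, ← hi, ← hj, selA]
        rw [if_neg (by simp only [decide_eq_true_eq]; omega)]
  · -- `i ≤ j`: the first vector is read by `ℓ ≤ i`, the second by `ℓ > j`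
    cases s
    · change parityFin _ (fun ℓ => selA i j ℓ && _) = subFn f (i + 1) _
      refine parity_prefix f hiL _ _ _ (fun ℓ => ?_) (fun ℓ hℓ => ?_)
      · simp only [selA, decide_eq_decide]; omega
      · rw [hdata]; congr 1; funext q
        simp only [zVec, ← hi, ← hj, selA]
        rw [if_pos (by simp only [decide_eq_true_eq]; omega)]
    · change parityFin _ (fun ℓ => selB i j ℓ && _) = subFn f (j + 1) _
      refine parity_suffix f hjL _ _ _ (fun ℓ => ?_) (fun ℓ hℓ => ?_)
      · simp only [selB, decide_eq_decide]; omega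
      · rw [hdata]; congr 1; funext q
        simp only [zVec, ← hi, ← hj, selA]
        rw [if_neg (by simp only [decide_eq_true_eq]; omega)]

/-! ### One level as a circuit -/

/-- The multiplexer formula is `if`. [folklore] -/
theorem mux_eq_ite (c a b : Bool) : (c && a || !c && b) = if c = true then a else b := by
  cases c <;> simp

/-- The pair `p` inside a family of pairs. [cite: Uhlig1992, proof of Thm. 2.1 (induction step)] -/
def pairOf {ρ : Type*} (X : (ρ × Bool) × Fin (m + k) → Bool) (p : ρ) : Bool × Fin (m + k) → Bool :=
  fun sq => X ((p, sq.1), sq.2)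

/-- **The level circuit** (Uhlig 1992, induction step `t → t + 1`): if every `g ∈ B_m` can be
evaluated on a `ρ`-indexed family of vectors by `S` gates, then every `f ∈ B_{m+k}` can be
evaluated on a `ρ × {0,1}`-indexed family (i.e. on `ρ`-many PAIRS) by
`(L+1) S + |ρ| (L+1) (2 U + 4 m + 6)` gates, `L = 2ᵏ`, `U = univBound (2k)`: control bits
(`|ρ| (L+1) 2 U`), selections (`|ρ| (L+1) 4 m`), the `L + 1` shared evaluations (`(L+1) S`), masked
parities (`2 |ρ| (2L+3)`). [cite: Uhlig1992, proof of Thm. 2.1, eqs. (17)–(23)] -/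
theorem cktSize_level {ρ : Type*} [Fintype ρ] [DecidableEq ρ] {S : ℕ}
    (IH : ∀ g : (Fin m → Bool) → Bool, CktSize B2 (directProd ρ g) S) :
    CktSize B2 (directProd (ρ × Bool) f)
      ((numIdx k + 1) * S + Fintype.card ρ * (numIdx k + 1) * (2 * univBound (k + k) + 4 * m + 6)) := by
  classical
  set Lc := numIdx k + 1 with hLc
  -- stage 1a: control bits (crudely, by the universal bound on the `2k` index bits of a pair)
  have h1a : CktSize B2 (fun (X : (ρ × Bool) × Fin (m + k) → Bool) =>
      Sum.elim X (fun (c : ρ × Fin Lc × Bool) => ctrl (pairOf X c.1) c.2.1 c.2.2))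
      (0 + Fintype.card (ρ × Fin Lc × Bool) * univBound (Fintype.card (Fin k ⊕ Fin k))) := by
    refine (CktSize.id B2).pair (CktSize.pi_const fun c => ?_)
    have hu := cktSize_univ (ι := Fin k ⊕ Fin k) fun v (_ : Unit) =>
      ctrlNum (num fun q => v (.inl q)) (num fun q => v (.inr q)) c.2.1 c.2.2
    exact (hu.rewire (Sum.elim (fun q => ((c.1, false), Fin.natAdd m q))
      (fun q => ((c.1, true), Fin.natAdd m q)))).congr fun X u => rfl
  -- stage 1b: the selected data vectors `z_ℓ` (one multiplexer per bit), control bits passed on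
  have h1b : CktSize B2 (fun (W : ((ρ × Bool) × Fin (m + k)) ⊕ (ρ × Fin Lc × Bool) → Bool) =>
      Sum.elim (fun (z : ρ × Fin Lc × Fin m) =>
          (W (.inr (z.1, z.2.1, false)) && W (.inl ((z.1, false), Fin.castAdd k z.2.2)) ||
            !W (.inr (z.1, z.2.1, false)) && W (.inl ((z.1, true), Fin.castAdd k z.2.2))))
        (fun (c : ρ × Fin Lc × Bool) => W (.inr c)))
      (Fintype.card (ρ × Fin Lc × Fin m) * 4 + 0) :=
    (CktSize.pi_const fun z => cktSize_mux _ _ _).pair (CktSize.proj B2 Sum.inr)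
  -- stage 2: the shared evaluations of the `g_ℓ` on the `ρ`-indexed selected vectors
  have h2 : CktSize B2 (fun (W : (ρ × Fin Lc × Fin m) ⊕ (ρ × Fin Lc × Bool) → Bool) =>
      Sum.elim (fun (lp : Fin Lc × ρ) => gFn f lp.1 fun q => W (.inl (lp.2, lp.1, q)))
        (fun (c : ρ × Fin Lc × Bool) => W (.inr c)))
      (Fintype.card (Fin Lc) * S + 0) := by
    refine (cktSize_prodPi (μ := Fin Lc)
      (F := fun (ℓ : Fin Lc) (W : (ρ × Fin Lc × Fin m) ⊕ (ρ × Fin Lc × Bool) → Bool) (p : ρ) =>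
        gFn f ℓ fun q => W (.inl (p, ℓ, q))) fun ℓ => ?_).pair (CktSize.proj B2 Sum.inr)
    exact ((IH (gFn f ℓ)).rewire fun pq : ρ × Fin m => Sum.inl (pq.1, ℓ, pq.2)).congr fun W p => rfl
  -- stage 3: the masked parities
  have h3 : CktSize B2 (fun (W : (Fin Lc × ρ) ⊕ (ρ × Fin Lc × Bool) → Bool) (ps : ρ × Bool) =>
      parityFin Lc fun ℓ => W (.inr (ps.1, ℓ, ps.2)) && W (.inl (ℓ, ps.1)))
      (Fintype.card (ρ × Bool) * (2 * Lc + 1)) :=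
    CktSize.pi_const fun ps =>
      ((cktSize_maskedParity Lc).rewire (Sum.elim (fun ℓ => Sum.inl (ℓ, ps.1))
        (fun ℓ => Sum.inr (ps.1, ℓ, ps.2)))).congr fun W u => rfl
  have H := ((h1a.comp h1b).comp h2).comp h3
  refine (H.of_le ?_).congr fun X ps => ?_
  · -- size bookkeeping
    simp only [Fintype.card_prod, Fintype.card_fin, Fintype.card_bool, Fintype.card_sum]
    have hL : 1 ≤ Lc := by omega
    nlinarith [Nat.zero_le (Fintype.card ρ), Nat.zero_le (univBound (k + k)), Nat.zero_le m]
  · -- semantics: this is `levelOut` of the pair `ps.1`, side `ps.2`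
    obtain ⟨p, s⟩ := ps
    have h := levelOut_eq f (pairOf X p) s
    simp only [levelOut, pairOf] at h
    simp only [Sum.elim_inl, Sum.elim_inr, directProd]
    rw [← h]
    congr 1
    funext ℓ
    congr 2
    funext q
    rw [mux_eq_ite]
    rfl

end Level

/-! ### The induction on the number of levels -/

section Induction

variable (base : ℕ → ℕ) (k : ℕ)

/-- The size of the `t`-level construction with block size `k` on `n` variables, over a base
bound `base n` for single evaluations: `S(0, n) = base n`,
`S(t+1, n) = (2ᵏ+1) S(t, n-k) + 2ᵗ (2ᵏ+1) (2 U + 4 (n-k) + 6)`. [cite: Uhlig1992, proof of Thm. 2.1, eqs. (21)–(23)] -/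
def size : ℕ → ℕ → ℕ
  | 0, n => base n
  | t + 1, n => (2 ^ k + 1) * size t (n - k) +
      2 ^ t * (2 ^ k + 1) * (2 * univBound (k + k) + 4 * (n - k) + 6)

variable {base}

/-- **Uhlig's induction** (Uhlig 1992, Thm. 2.1, the networks `A_{f,n,k,t}`): with `t` levels of block
size `k`, every `f ∈ B_n` (`n ≥ t k`) is evaluated on the `2ᵗ` vectors indexed by `{0,1}ᵗ` by
`size base k t n` gates, given circuits of size `base n'` for single functions of `n'` variables.
[cite: Uhlig1992, Thm. 2.1 (proof, eqs. (21)–(23))] -/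
theorem cktSize_directProd_cube (hbase : ∀ (n : ℕ) (g : (Fin n → Bool) → Unit → Bool), CktSize B2 g (base n)) :
    ∀ (t n : ℕ), t * k ≤ n → ∀ f : (Fin n → Bool) → Bool,
      CktSize B2 (directProd (Fin t → Bool) f) (size base k t n)
  | 0, n, _, f => by
    have h := (hbase n fun x (_ : Unit) => f x).rewire
      (fun i => ((finZeroElim : Fin 0 → Bool), i) : Fin n → (Fin 0 → Bool) × Fin n)
    exact (h.outMap fun _ => ()).congr fun X p => by
      simp only [directProd]
      rw [Subsingleton.elim p finZeroElim]
  | t + 1, n, htn, f => by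
    obtain ⟨m, rfl⟩ : ∃ m, n = m + k := ⟨n - k, by rw [Nat.succ_mul] at htn; omega⟩
    have htm : t * k ≤ m := by rw [Nat.succ_mul] at htn; omega
    have hlev := cktSize_level (ρ := Fin t → Bool) f fun g => cktSize_directProd_cube hbase t m htm g
    have h := (hlev.rewire (fun wi : ((Fin t → Bool) × Bool) × Fin (m + k) =>
      ((Fin.cons wi.1.2 wi.1.1 : Fin (t + 1) → Bool), wi.2))).outMap
        fun v : Fin (t + 1) → Bool => (Fin.tail v, v 0)
    refine (h.of_le ?_).congr fun X v => ?_
    · simp only [size, Nat.add_sub_cancel, numIdx, Fintype.card_fun, Fintype.card_fin,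
        Fintype.card_bool]
      rfl
    · simp only [directProd]
      congr 1
      funext q
      rw [Fin.cons_self_tail]

/-! ### Size analysis -/

/-- The per-level overhead factor `Q(n) = 2 U + 4 n + 6`, `U = univBound (2k)`. [cite: Uhlig1992, proof of Thm. 2.1, eq. (19)] -/
def overhead (n : ℕ) : ℕ := 2 * univBound (k + k) + 4 * n + 6

/-- `Q` is monotone. [folklore] -/
theorem overhead_mono {n n' : ℕ} (h : n ≤ n') : overhead k n ≤ overhead k n' := by
  unfold overhead; omega

/-- **Unrolling the recursion** (Uhlig 1992, eq. (23)):
`S(t, n) ≤ (2ᵏ+1)ᵗ (base(n - t k) + t 2ᵗ Q(n))`. [cite: Uhlig1992, proof of Thm. 2.1, eq. (23)] -/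
theorem size_le : ∀ t n : ℕ,
    size base k t n ≤ (2 ^ k + 1) ^ t * (base (n - t * k) + t * 2 ^ t * overhead k n)
  | 0, n => by simp [size]
  | t + 1, n => by
    have ih := size_le t (n - k)
    have hQ : overhead k (n - k) ≤ overhead k n := overhead_mono k (Nat.sub_le n k)
    have hsub : n - k - t * k = n - (t + 1) * k := by rw [Nat.succ_mul, Nat.sub_sub, Nat.add_comm]
    rw [size, pow_succ, pow_succ]
    rw [hsub] at ih
    have hA1 : 1 ≤ (2 ^ k + 1) ^ t := Nat.one_le_pow _ _ (Nat.succ_pos _)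
    set A := (2 ^ k + 1) ^ t with hA
    set P := 2 ^ t with hP
    set K1 := 2 ^ k + 1 with hK1
    set b := base (n - (t + 1) * k) with hb
    have hov : 2 * univBound (k + k) + 4 * (n - k) + 6 = overhead k (n - k) := rfl
    rw [hov]
    calc K1 * size base k t (n - k) + P * K1 * overhead k (n - k)
        ≤ K1 * (A * (b + t * P * overhead k n)) + P * K1 * overhead k n := by
          gcongr
          exact ih.trans (Nat.mul_le_mul_left _ (Nat.add_le_add_left
            (Nat.mul_le_mul_left _ hQ) _))
      _ ≤ A * K1 * (b + (t + 1) * (P * 2) * overhead k n) := by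
          have h1 : P * K1 * overhead k n ≤ A * K1 * (P * overhead k n) := by
            calc P * K1 * overhead k n = 1 * K1 * (P * overhead k n) := by ring
              _ ≤ A * K1 * (P * overhead k n) := by gcongr
          nlinarith [h1, Nat.zero_le (A * K1 * (P * overhead k n)), Nat.zero_le (t * P * overhead k n)]

/-- `K (K+1)ᵗ ≤ Kᵗ (K + 2t)` for `2t ≤ K` (so `(1 + 1/K)ᵗ ≤ 1 + 2t/K`). [folklore] -/
theorem mul_succ_pow_le (K : ℕ) : ∀ t : ℕ, 2 * t ≤ K → K * (K + 1) ^ t ≤ K ^ t * (K + 2 * t)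
  | 0, _ => by simp
  | t + 1, ht => by
    have ih := mul_succ_pow_le K t (by omega)
    calc K * (K + 1) ^ (t + 1) = K * (K + 1) ^ t * (K + 1) := by ring
      _ ≤ K ^ t * (K + 2 * t) * (K + 1) := Nat.mul_le_mul_right _ ih
      _ = K ^ t * ((K + 2 * t) * (K + 1)) := by ring
      _ ≤ K ^ t * (K * (K + 2 * (t + 1))) := Nat.mul_le_mul_left _ (by nlinarith)
      _ = K ^ (t + 1) * (K + 2 * (t + 1)) := by ring

/-- `(K+1)ᵗ ≤ 2 Kᵗ` for `2t ≤ K`. [folklore] -/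
theorem succ_pow_le_two_mul_pow {K t : ℕ} (ht : 2 * t ≤ K) : (K + 1) ^ t ≤ 2 * K ^ t := by
  rcases Nat.eq_zero_or_pos K with rfl | hK
  · obtain rfl : t = 0 := by omega
    simp
  · have h := mul_succ_pow_le K t ht
    have h2 : K ^ t * (K + 2 * t) ≤ K * (2 * K ^ t) := by nlinarith [Nat.zero_le (K ^ t)]
    exact Nat.le_of_mul_le_mul_left (h.trans h2) hK

/-- **The estimate.** With block size `k = ⌊log₂ n⌋ + 1` and `(2t + 8)(⌊log₂ n⌋ + 2) ≤ n`, the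
`t`-level construction over Lupanov-type base circuits (`n' · base n' ≤ 36 · 2^{n'}`) has
`n · S(t, n) ≤ 160 · 2ⁿ`. [cite: Uhlig1992, proof of Thm. 2.1 (choice of k_n, eq. (25))] -/
theorem mul_size_le (hbase : ∀ n, n * base n ≤ 36 * 2 ^ n) {n t : ℕ}
    (hn : (2 * t + 8) * (Nat.log 2 n + 2) ≤ n) :
    n * size base (Nat.log 2 n + 1) t n ≤ 160 * 2 ^ n := by
  set L := Nat.log 2 n with hL
  set k := L + 1 with hk
  -- basic facts about `n`, `L`, `K = 2^k`
  have hn16 : 16 ≤ n := le_trans (by nlinarith) hn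
  have hnK : n < 2 ^ k := Nat.lt_pow_succ_log_self (by norm_num) n
  have hKn : 2 ^ k ≤ 2 * n := by
    rw [hk, pow_succ]
    have := Nat.pow_log_le_self 2 (show n ≠ 0 by omega)
    rw [← hL] at this
    omega
  -- the budget: `2 t (L+2) + 8 (L+2) ≤ n`
  have hbud : 2 * (t * (k + 1)) + 8 * (L + 2) ≤ n := by
    have : (2 * t + 8) * (L + 2) = 2 * (t * (k + 1)) + 8 * (L + 2) := by rw [hk]; ring
    omega
  have htk2 : 2 * (t * k) ≤ n := by nlinarith
  have ht2 : 2 * t ≤ 2 ^ k := by nlinarith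
  have htn : t ≤ n := by nlinarith
  -- (i) `(K+1)^t ≤ 2 K^t`
  have hpow : (2 ^ k + 1) ^ t ≤ 2 * 2 ^ (k * t) := by
    have := succ_pow_le_two_mul_pow ht2
    rwa [← pow_mul] at this
  -- (ii) the main term: `n · 2^{kt} · base(n - tk) ≤ 72 · 2^n`
  set n' := n - t * k with hn'
  have hn'n : n ≤ 2 * n' := by omega
  have hsplit : k * t + n' = n := by rw [hn', Nat.mul_comm]; omega
  have hmain : n * (2 ^ (k * t) * base n') ≤ 72 * 2 ^ n := by
    have h1 : n * base n' ≤ 2 * (n' * base n') := by nlinarith [Nat.zero_le (base n')]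
    have h2 := hbase n'
    calc n * (2 ^ (k * t) * base n') = 2 ^ (k * t) * (n * base n') := by ring
      _ ≤ 2 ^ (k * t) * (2 * (36 * 2 ^ n')) := Nat.mul_le_mul_left _ (h1.trans (by omega))
      _ = 72 * (2 ^ (k * t) * 2 ^ n') := by ring
      _ = 72 * 2 ^ n := by rw [← pow_add, hsplit]
  -- (iii) the overhead term: `n · 2^{kt} · t · 2^t · Q(n) ≤ 7 · 2^n`
  have hQ : overhead k n ≤ 50 * (n * n) := by
    have hU : univBound (k + k) + 4 = 5 * 2 ^ (k + k) := by
      -- `univBound m = 5 · 2ᵐ - 4` (CircuitComposition.lean)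
      suffices h : ∀ m, univBound m + 4 = 5 * 2 ^ m from h _
      intro m
      induction m with
      | zero => rfl
      | succ m ih => rw [univBound, pow_succ]; omega
    have hKK : 2 ^ (k + k) ≤ 4 * (n * n) := by
      rw [pow_add]; nlinarith
    unfold overhead
    nlinarith
  have hn4 : n * n * (n * n) < 2 ^ (4 * k) := by
    have : 2 ^ (4 * k) = 2 ^ k * 2 ^ k * (2 ^ k * 2 ^ k) := by
      rw [show 4 * k = k + k + (k + k) by ring, pow_add, pow_add]
    rw [this]
    have h2 : n * n < 2 ^ k * 2 ^ k := Nat.mul_lt_mul'' hnK hnK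
    exact Nat.mul_lt_mul'' h2 h2
  have hexp : 4 * k + (k * t + t) + 4 ≤ n := by
    have : k * t + t = t * (k + 1) := by ring
    omega
  have hover : n * (2 ^ (k * t) * (t * 2 ^ t * overhead k n)) ≤ 7 * 2 ^ n := by
    -- `≤ 50 · n⁴ · 2^{kt + t} ≤ 50 · 2^{4k + kt + t} ≤ 50 · 2^n / 16`
    have h1 : n * (2 ^ (k * t) * (t * 2 ^ t * overhead k n)) ≤
        50 * (n * n * (n * n)) * 2 ^ (k * t + t) := by
      rw [pow_add]
      have := Nat.zero_le (2 ^ (k * t) * 2 ^ t)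
      nlinarith [hQ, htn, Nat.zero_le (2 ^ (k * t)), Nat.zero_le (2 ^ t),
        Nat.mul_le_mul (Nat.mul_le_mul_left (2 ^ (k * t) * 2 ^ t) htn) hQ]
    have h2 : 50 * (n * n * (n * n)) * 2 ^ (k * t + t) ≤ 50 * 2 ^ (4 * k + (k * t + t)) := by
      rw [pow_add 2 (4 * k)]
      have := hn4.le
      nlinarith [Nat.zero_le (2 ^ (k * t + t))]
    have h3 : 16 * 2 ^ (4 * k + (k * t + t)) ≤ 2 ^ n := by
      calc 16 * 2 ^ (4 * k + (k * t + t)) = 2 ^ (4 * k + (k * t + t) + 4) := by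
            rw [pow_add _ _ 4]; ring
        _ ≤ 2 ^ n := Nat.pow_le_pow_right (by norm_num) hexp
    omega
  -- assemble
  have hS := size_le k (base := base) t n
  calc n * size base k t n
      ≤ n * ((2 ^ k + 1) ^ t * (base n' + t * 2 ^ t * overhead k n)) := Nat.mul_le_mul_left _ hS
    _ ≤ n * (2 * 2 ^ (k * t) * (base n' + t * 2 ^ t * overhead k n)) := by gcongr
    _ = 2 * (n * (2 ^ (k * t) * base n')) + 2 * (n * (2 ^ (k * t) * (t * 2 ^ t * overhead k n))) := by
        ring
    _ ≤ 2 * (72 * 2 ^ n) + 2 * (7 * 2 ^ n) := by gcongr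
    _ ≤ 160 * 2 ^ n := by omega

/-! ### Mass production for an arbitrary index set -/

/-- From the cube `{0,1}ᵗ` to any index set `ρ` with `|ρ| ≤ 2ᵗ`: embed `ρ`, rewire, forget the
surplus outputs. [cite: Uhlig1992, Thm. 2.1 ("we can assume r(n) = 2^{t_n}")] -/
theorem cktSize_directProd_of_card_le {n t S : ℕ} {f : (Fin n → Bool) → Bool}
    (h : CktSize B2 (directProd (Fin t → Bool) f) S) {ρ : Type*} [Fintype ρ]
    (hρ : Fintype.card ρ ≤ 2 ^ t) : CktSize B2 (directProd ρ f) S := by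
  classical
  rcases isEmpty_or_nonempty ρ with hρ0 | hρ1
  · exact (CktSize.of_isEmpty B2 _).of_le (Nat.zero_le _)
  · have hcard : Fintype.card ρ ≤ Fintype.card (Fin t → Bool) := by simpa using hρ
    obtain ⟨emb⟩ := Function.Embedding.nonempty_of_card_le hcard
    set π : (Fin t → Bool) → ρ := Function.invFun emb with hπ
    have hπe : ∀ p, π (emb p) = p := Function.leftInverse_invFun emb.injective
    have h' := (h.rewire fun wi : (Fin t → Bool) × Fin n => (π wi.1, wi.2)).outMap emb
    exact h'.congr fun X p => by simp [directProd, hπe]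

end Induction

/-! ### The theorem -/

/-- **Uhlig's mass-production theorem, cube form**: under `(2t + 8)(⌊log₂ n⌋ + 2) ≤ n`, every
`f ∈ B_n` is evaluated on `2ᵗ` arbitrary vectors by a `B₂`-circuit of size `≤ 160 · 2ⁿ/n`.
[cite: Uhlig1992, Thm. 2.1] -/
theorem cktSize_directProd_cube_lupanov {n t : ℕ} (hn : (2 * t + 8) * (Nat.log 2 n + 2) ≤ n)
    (f : (Fin n → Bool) → Bool) :
    CktSize B2 (directProd (Fin t → Bool) f) (160 * 2 ^ n / n) := by
  have hn1 : 1 ≤ n := le_trans (by nlinarith) hn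
  have htk : t * (Nat.log 2 n + 1) ≤ n := by nlinarith
  have h := cktSize_directProd_cube (base := lupanovBound) (Nat.log 2 n + 1)
    (fun n g => cktSize_lupanov g) t n htk f
  refine h.of_le ?_
  rw [Nat.le_div_iff_mul_le hn1, mul_comm]
  exact mul_size_le (base := lupanovBound) mul_lupanovBound_le hn

end Uhlig

/-- **Uhlig's mass-production theorem** (Uhlig 1974; Uhlig 1992, Thm. 2.1; Wegener 1987,
Thm. 10.2.3), weak form: if `(2t + 8)(⌊log₂ n⌋ + 2) ≤ n` (in particular for `log₂ r = O(log n)`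
and `n` large, or `log₂ r ≤ n / (5 log₂ n)`), then for every `f : {0,1}ⁿ → {0,1}` and every index
set `ρ` of at most `r = 2ᵗ` vectors, the direct product `X ↦ (f(X_p))_{p ∈ ρ}` has a circuit over
`B₂` with at most `160 · 2ⁿ / n` gates — the cost of a single hard function up to the constant
(Uhlig: `(1 + o(1)) ρ 2ⁿ/n` for `log r = o(n / log n)`). [cite: Uhlig1992, Thm. 2.1 (pp. 166–172)] -/
theorem cktSize_massProduction {n t : ℕ} (hn : (2 * t + 8) * (Nat.log 2 n + 2) ≤ n)
    (f : (Fin n → Bool) → Bool) {ρ : Type*} [Fintype ρ] (hρ : Fintype.card ρ ≤ 2 ^ t) :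
    CktSize B2 (directProd ρ f) (160 * 2 ^ n / n) :=
  Uhlig.cktSize_directProd_of_card_le (Uhlig.cktSize_directProd_cube_lupanov hn f) hρ

end Literature.Computability.Complexity
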